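import Mathlib
import Literature.NumberTheory.GaussSums.DilationKernelForm
import Literature.Combinatorics.SimpleGraph.PaleyT441CharSum
import HarnessLib

/-!
# Kunisky–Yu `T^{4,4,1}`, step 2: the zero-frequency (translation-invariant) block is `O(p)` — PROVED

Topic `Literature/Combinatorics/SimpleGraph` (support for `kuniskyYu2022_theorem_1_2`).
The Paley pair kernel is `g_{s,t}(u) = χ(u) χ(u − t) χ(u + s) χ(u + s − t)` (so that
`χ((a−c)(a−d)(b−c)(b−d)) = g_{b−a,d−c}(a − c)`).  Its zero-frequency block
`K(s,t) = ∑_u g_{s,t}(u)` is dilation invariant (`χ(i)⁴ = 1`), hence diagonalised by the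
multiplicative characters with eigenvalues `∑_λ K(1,λ) φ(λ) = ∑_{x,y} χ(x(x+1)) χ(y(y+1)) φ(x−y)`,
all of modulus `≤ 2p` (Kunisky–Yu 2022, Theorem 4.22 and (138), PROVED in
`PaleyT441CharSum.lean`).  By `Literature.NumberTheory.GaussSums.norm_dilationKernel_form_le`:

  `|∑_{s,t} y_s conj(y_t) ∑_u g_{s,t}(u)| ≤ 2p ∑_s |y_s|²`   for all `y` with `y_0 = 0`

(`norm_paleyKernel_zeroFreq_form_le`), i.e. `‖Q₀ S(ψ) Q₀‖, ‖M₀‖ ≤ 2p` in Kunisky–Yu's notation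
((138): "so `‖Q₀ S(ψ) Q₀‖ ≤ 2p` for all `S(ψ)`").

## References

* D. Kunisky, X. Yu, arXiv:2211.02713 (2022), §4.7.3, (136)–(138).  [KuniskyYu2022]
-/

noncomputable section

open Finset
open Literature.NumberTheory.GaussSums

namespace Literature.Combinatorics.SimpleGraph

section ZeroFreq

variable {p : ℕ} [hp : Fact p.Prime]

/-- `χ(i)⁴`-invariance: the Paley pair kernel is dilation invariant,
`g_{is,it}(iu) = g_{s,t}(u)` for `i ≠ 0`. [cite: KuniskyYu2022, §4.7.1 (114)] -/
theorem paleyKernel_dilation {i : ZMod p} (hi : i ≠ 0) (s t u : ZMod p) :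
    ((quadraticChar (ZMod p) (i * u) : ℤ) : ℂ) *
        ((quadraticChar (ZMod p) (i * u - i * t) : ℤ) : ℂ) *
        ((quadraticChar (ZMod p) (i * u + i * s) : ℤ) : ℂ) *
        ((quadraticChar (ZMod p) (i * u + i * s - i * t) : ℤ) : ℂ) =
      ((quadraticChar (ZMod p) u : ℤ) : ℂ) * ((quadraticChar (ZMod p) (u - t) : ℤ) : ℂ) *
        ((quadraticChar (ZMod p) (u + s) : ℤ) : ℂ) *
        ((quadraticChar (ZMod p) (u + s - t) : ℤ) : ℂ) := by
  have h2 : (quadraticChar (ZMod p) i) ^ 2 = 1 := quadraticChar_sq_one hi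
  have e1 : i * u - i * t = i * (u - t) := by ring
  have e2 : i * u + i * s = i * (u + s) := by ring
  have e3 : i * u + i * s - i * t = i * (u + s - t) := by ring
  rw [e3, e1, e2, map_mul, map_mul, map_mul, map_mul]
  push_cast
  have h4 : ((quadraticChar (ZMod p) i : ℤ) : ℂ) ^ 4 = 1 := by
    rw [show (4 : ℕ) = 2 * 2 by norm_num, pow_mul]
    exact_mod_cast (by rw [h2, one_pow] : ((quadraticChar (ZMod p) i) ^ 2) ^ 2 = 1)
  linear_combination (((quadraticChar (ZMod p) u : ℤ) : ℂ) *
    ((quadraticChar (ZMod p) (u - t) : ℤ) : ℂ) * ((quadraticChar (ZMod p) (u + s) : ℤ) : ℂ) *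
    ((quadraticChar (ZMod p) (u + s - t) : ℤ) : ℂ)) * h4

/-- The zero-frequency block `K(s,t) = ∑_u g_{s,t}(u)` is dilation invariant.
[cite: KuniskyYu2022, Proposition 4.19] -/
theorem paleyKernel_zeroFreq_dilation {i : ZMod p} (hi : i ≠ 0) (s t : ZMod p) :
    ∑ u : ZMod p, ((quadraticChar (ZMod p) u : ℤ) : ℂ) *
        ((quadraticChar (ZMod p) (u - i * t) : ℤ) : ℂ) *
        ((quadraticChar (ZMod p) (u + i * s) : ℤ) : ℂ) *
        ((quadraticChar (ZMod p) (u + i * s - i * t) : ℤ) : ℂ) =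
      ∑ u : ZMod p, ((quadraticChar (ZMod p) u : ℤ) : ℂ) *
        ((quadraticChar (ZMod p) (u - t) : ℤ) : ℂ) *
        ((quadraticChar (ZMod p) (u + s) : ℤ) : ℂ) *
        ((quadraticChar (ZMod p) (u + s - t) : ℤ) : ℂ) := by
  refine (Fintype.sum_bijective (i * ·) (mulLeft_bijective₀ i hi) _ _ fun u => ?_).symm
  exact (paleyKernel_dilation hi s t u).symm

/-- **The zero-frequency block of `T^{4,4,1}` is `O(p)`** (Kunisky–Yu (138):
"`‖Q₀ S(ψ) Q₀‖ ≤ 2p` for all `S(ψ)`"; here for the whole translation-invariant block, as a form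
bound): for `p` an odd prime and every `y : 𝔽_p → ℂ` with `y 0 = 0`,
`|∑_{s,t} y_s conj(y_t) ∑_u χ(u) χ(u−t) χ(u+s) χ(u+s−t)| ≤ 2p ∑_s |y_s|²`.
[cite: KuniskyYu2022, Theorem 4.22] -/
theorem norm_paleyKernel_zeroFreq_form_le (hp2 : p ≠ 2) (y : ZMod p → ℂ) (hy : y 0 = 0) :
    ‖∑ s : ZMod p, ∑ t : ZMod p, y s * (starRingEnd ℂ) (y t) *
        ∑ u : ZMod p, ((quadraticChar (ZMod p) u : ℤ) : ℂ) *
          ((quadraticChar (ZMod p) (u - t) : ℤ) : ℂ) *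
          ((quadraticChar (ZMod p) (u + s) : ℤ) : ℂ) *
          ((quadraticChar (ZMod p) (u + s - t) : ℤ) : ℂ)‖ ≤
      (2 * p) * ∑ s : ZMod p, ‖y s‖ ^ 2 := by
  classical
  refine norm_dilationKernel_form_le (F := ZMod p)
    (fun s t => ∑ u : ZMod p, ((quadraticChar (ZMod p) u : ℤ) : ℂ) *
      ((quadraticChar (ZMod p) (u - t) : ℤ) : ℂ) *
      ((quadraticChar (ZMod p) (u + s) : ℤ) : ℂ) *
      ((quadraticChar (ZMod p) (u + s - t) : ℤ) : ℂ))
    (fun i hi s t => paleyKernel_zeroFreq_dilation hi s t) (2 * p) (fun φ => ?_) y hy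
  exact norm_paleyKernel_eigenvalue_le hp2 φ

end ZeroFreq

end Literature.Combinatorics.SimpleGraph

end
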